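import Summits.NavierStokesRegularity.NavierStokesRegularity.Theorems.LerayQuarterDissipationFiniteDissipationLiouvillePointGroupTools
import Summits.NavierStokesRegularity.NavierStokesRegularity.Theorems.DssFarFieldSlavingBlowupTypeIDssProfileTwistNormalForm
import Mathlib.NumberTheory.DiophantineApproximation.Basic
import HarnessLib

/-!
# Crux `FiniteDissipationLiouville` (stmt-NavierStokesRegularity-22144): the POINT GROUP of a
# finite-dissipation Type-I singularity — every rotational symmetry has finite order `≤ N(C,K)`

Theorems file of route `LerayQuarterDissipation` (lead prover ns-lqd-lead g10, cell ns-idea-3;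
`--supports` the crux). Navier–Stokes regularity is NOT proved by anything here; no summit is; the
crux stays open-problem hard (its wall `∀ c > 1, TypeIDSSLiouville c` is NECESSARY, `…Hardness`).

Portrait axis: DISCRETE spatial symmetries of a counterexample. `𝒟_{C,K}` is the finite-dissipation
stratum (`IsTypeIAncientMild C w` + Leray's quarter-rate law), *singular* = unbounded on every backward
parabolic cylinder at the origin, `ρ_{g,α} x = g (R_α (g⁻¹ x))` the rotation by `α` about the apex axis
`g e₃`. ANTECEDENT (acknowledged, imported, not re-proved): `OneSymmetricSlice.Quantised` (seat
ns-lqd-p2 g7) — ONE slice `δ`-almost equivariant under the WHOLE cyclic group `C_n = {R_{2πk/n}}_k`,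
`n ≥ N(C,K)`, forces regularity (`oneQuantisedSlice`, on top of `oneSymmetricSlice_proof`, 24452).
What this file adds:

* tools (`…PointGroupTools.lean`): `iterate_defect_le` / `iterate_symmetry` / `symmetry_neg` (a
  ONE-GENERATOR hypothesis on the similarity ball propagates along the powers) and
  `defect_allAngles_le` (ANY real angle `α > 0`: a `ρ_{g,α}`-defect `≤ η` gives a `ρ_{g,θ}`-defect
  `≤ (2π/α) η + α (L ρ + B)` for EVERY `θ`).
* `almostDiscreteSymmetry_leaf` — **ONE SLICE, ONE GENERATOR, ONE SMALL ANGLE**: `∃ α₀ κ R > 0`, a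
  member of `𝒟_{C,K}` with `√(−t)‖w(t, ρ_{g,α} x) − ρ_{g,α} w(t, x)‖ ≤ κ α` on `B(0, R√(−t))` at ONE
  instant for ONE angle `0 < α ≤ α₀` is regular (the hypothesis tests the generator only, with an
  `O(α)` tolerance; gradient bound `exists_gauge_norm_fderiv_le_of_typeI` + `oneSymmetricSlice_proof`).
  `discreteSymmetry_leaf`: the exact form (`η = 0`), any small real angle.
* `symmetry_finiteOrder_of_singular` — **THE CRYSTALLOGRAPHIC RESTRICTION**: `∃ N R`, every exact
  rotational symmetry `ρ_{g,α}` (ANY real `α`) of a slice of a SINGULAR member on `B(0, R√(−t))` has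
  finite order `≤ N(C,K)`: `k α ∈ 2πℤ` for some `1 ≤ k ≤ N` (Dirichlet's approximation theorem gives
  `1 ≤ k ≤ N` with `kα` within `2π/(N+1) < α₀` of `2πℤ`; `ρ_{g,α}^k` is then a small-angle symmetry,
  or its inverse is). Hence `not_symmetric_of_irrational_of_singular` (no symmetry by an angle
  irrational in units of `2π` — infinite-order rotational symmetries are impossible, the case the
  cyclic-group statements do not see) and the portrait clause `smallRotation_defect_of_singular`.

* `isometrySymmetry_finiteOrder_of_singular` — **THE FULL POINT GROUP IS TORSION OF BOUNDED
  EXPONENT**: every linear isometry `S ∈ O(3)` (proper or improper) under which a slice of a singular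
  member is symmetric on the similarity ball satisfies `S^k = 1` for some `1 ≤ k ≤ 2N(C,K)` (Euler's
  rotation theorem for `S ∘ S`, tree `TwistNormalForm.exists_trans_self_eq_conj_rotZLIE`).

PORTRAIT: the point group of a finite-dissipation Type-I singularity (e.g. of a backward (rotated) DSS
Type-I profile, Bradshaw–Tsai OP 5.1) is generated by rotations of order `≤ N(C,K)` plus whatever
improper elements it has; polyhedral and low-order cyclic/dihedral groups are not excluded. HONEST
FRAMING: `α₀, κ, N` descend from the compactness constant of `OneSymmetricSlice` (ineffective); no DSS
scenario with a small point group is removed; the crux is FRONTIER (blocked on `TypeIDSSLiouville`).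

References: G. Seregin, V. Šverák, Comm. PDE 34 (2009) Thm. 1.1; G. Koch, N. Nadirashvili,
G. Seregin, V. Šverák, Acta Math. 203 (2009) §4 (4.10); Z. Bradshaw, T.-P. Tsai, Comm. PDE 42 (2017)
§5 OP 5.1; Dirichlet's approximation theorem (Mathlib `Real.exists_int_int_abs_mul_sub_le`).
-/

noncomputable section

-- the summit and its single sub-problem share the name (CONVENTIONS §1), as in every Theorems file
set_option linter.dupNamespace false

namespace Summit.NavierStokesRegularity.NavierStokesRegularity.Theorems.FiniteDissipationLiouville.PointGroup

open MeasureTheory Set Filter Topology Metric Function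
open Literature.Analysis Literature.Analysis.FluidPDE
open Summit.NavierStokesRegularity.NavierStokesRegularity.Theorems.OneSymmetricSlice.Quantised
open scoped ENNReal NNReal

/-! ### The leaves -/

/-- **ONE SLICE, ONE SMALL ANGLE (almost-symmetric form).** For all `C, K` there are
`α₀, κ, R > 0` such that: a member `w` of the finite-dissipation stratum `𝒟_{C,K}` having ONE slice
`t < 0`, ONE linear isometry `g` and ONE angle `0 < α ≤ α₀` with
`√(−t) ‖w(t, ρ_{g,α} x) − ρ_{g,α} w(t, x)‖ ≤ κ α` for all `x ∈ B(0, R√(−t))` is bounded on some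
backward parabolic cylinder at the origin. [cite: SereginSverak2009, Thm. 1.1 (via `OneSymmetricSlice`)] -/
theorem almostDiscreteSymmetry_leaf (C K : ℝ) :
    ∃ α₀ > 0, ∃ κ > 0, ∃ R > 0,
      ∀ w : ℝ → EuclideanSpace ℝ (Fin 3) → EuclideanSpace ℝ (Fin 3), IsTypeIAncientMild C w →
      (∀ s : ℝ, s < 0 → ∫⁻ x, ‖fderiv ℝ (w s) x‖ₑ ^ 2 ≤ ENNReal.ofReal (K / Real.sqrt (-s))) →
      (∃ t < 0, ∃ g : EuclideanSpace ℝ (Fin 3) ≃ₗᵢ[ℝ] EuclideanSpace ℝ (Fin 3), ∃ α : ℝ,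
        0 < α ∧ α ≤ α₀ ∧ ∀ x ∈ ball (0 : EuclideanSpace ℝ (Fin 3)) (R * Real.sqrt (-t)),
          Real.sqrt (-t) * ‖w t (g (rotZ α (g.symm x))) - g (rotZ α (g.symm (w t x)))‖ ≤ κ * α) →
      ¬ (∀ r > 0, ∀ M : ℝ, ∃ t ∈ Set.Ioo (-(r ^ 2)) (0 : ℝ),
          ∃ x ∈ ball (0 : EuclideanSpace ℝ (Fin 3)) r, M < ‖w t x‖) := by
  have hOSS := oneSymmetricSlice_proof
  unfold Summit.NavierStokesRegularity.NavierStokesRegularity.Theses.CalmSliceGate.OneSymmetricSlice at hOSS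
  obtain ⟨δ, hδ, R, hR, H⟩ := hOSS C K
  obtain ⟨K₀', hK₀'⟩ := exists_gauge_norm_fderiv_le_of_typeI C
  set K₀ : ℝ := max K₀' 0 with hK₀
  have hK₀0 : 0 ≤ K₀ := le_max_right _ _
  set A : ℝ := K₀ * R + |C| + 1 with hA
  have hApos : 0 < A := by positivity
  refine ⟨δ / (2 * A), by positivity, δ / (4 * Real.pi), by positivity, R, hR,
    fun w hw hlaw ⟨t, ht, g, α, hα, hαle, hsym⟩ => ?_⟩
  refine H w hw hlaw ⟨t, ht, g, fun θ x hx => ?_⟩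
  have hnt : 0 < -t := neg_pos.2 ht
  have hst : 0 < Real.sqrt (-t) := Real.sqrt_pos.2 hnt
  have hC0 : 0 ≤ C := hw.nonneg
  -- the data of the deterministic estimate at the slice `t`
  have hdiff : ∀ x, DifferentiableAt ℝ (w t) x := fun x =>
    ((hw.contDiff_slice ht).differentiable (by simp)).differentiableAt
  have hL : ∀ x, ‖fderiv ℝ (w t) x‖ ≤ K₀ / (-t) := fun x => by
    rw [le_div_iff₀ hnt, mul_comm]
    exact (hK₀' hw t ht x).trans (le_max_left _ _)
  have hB : ∀ x ∈ ball (0 : EuclideanSpace ℝ (Fin 3)) (R * Real.sqrt (-t)), ‖w t x‖ ≤ C / Real.sqrt (-t) :=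
    fun x _ => hw.norm_le ht x
  have hη : ∀ x ∈ ball (0 : EuclideanSpace ℝ (Fin 3)) (R * Real.sqrt (-t)),
      ‖w t (g (rotZ α (g.symm x))) - g (rotZ α (g.symm (w t x)))‖ ≤ δ / (4 * Real.pi) * α / Real.sqrt (-t) := by
    intro x hx
    rw [le_div_iff₀ hst, mul_comm]
    exact hsym x hx
  have hest := defect_allAngles_le g hα (by positivity) hdiff hL hB hη θ x hx
  -- bookkeeping: `√(−t) × estimate ≤ δ`
  have e1 : 2 * Real.pi / α * (δ / (4 * Real.pi) * α / Real.sqrt (-t)) = δ / 2 / Real.sqrt (-t) := by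
    field_simp
    ring
  have e2 : α * (K₀ / (-t) * (R * Real.sqrt (-t)) + C / Real.sqrt (-t)) =
      α * (K₀ * R + C) / Real.sqrt (-t) := by
    obtain ⟨s, hs⟩ : ∃ s : ℝ, s = Real.sqrt (-t) := ⟨_, rfl⟩
    have hs0 : s ≠ 0 := by rw [hs]; exact hst.ne'
    have hsq : -t = s * s := by rw [hs, Real.mul_self_sqrt hnt.le]
    rw [← hs, hsq]
    have e3 : K₀ / (s * s) * (R * s) = K₀ * R / s := by
      rw [div_mul_eq_mul_div, div_eq_div_iff (mul_ne_zero hs0 hs0) hs0]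
      ring
    rw [e3, ← add_div, mul_div_assoc]
  rw [e1, e2] at hest
  have hfin : Real.sqrt (-t) * ‖w t (g (rotZ θ (g.symm x))) - g (rotZ θ (g.symm (w t x)))‖ ≤
      δ / 2 + α * (K₀ * R + C) := by
    have := mul_le_mul_of_nonneg_left hest hst.le
    rw [mul_add, mul_div_cancel₀ _ hst.ne', mul_div_cancel₀ _ hst.ne'] at this
    exact this
  refine hfin.trans ?_
  have hle : K₀ * R + C ≤ A := by
    rw [hA]; linarith [le_abs_self C]
  have hnn : 0 ≤ K₀ * R + C := by positivity
  have h3 : α * (K₀ * R + C) ≤ δ / (2 * A) * A :=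
    mul_le_mul hαle hle hnn (by positivity)
  -- `δ/(2A) * A = δ/2`
  have h4 : δ / (2 * A) * A = δ / 2 := by
    rw [div_mul_eq_mul_div, div_eq_div_iff (mul_ne_zero two_ne_zero hApos.ne') two_ne_zero]
    ring
  linarith [h3, h4]

/-- **ONE SLICE, ONE SMALL EXACT ROTATIONAL SYMMETRY ⇒ REGULAR.** For all `C, K` there are
`α₀, R > 0` such that a member of `𝒟_{C,K}` with ONE slice `t < 0` EXACTLY symmetric, on the
similarity ball `B(0, R√(−t))`, under the rotation by an angle `0 < α ≤ α₀` about SOME axis through the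
apex (`w(t, ρ_{g,α} x) = ρ_{g,α} w(t, x)`) is bounded on some backward parabolic cylinder at the
origin. [cite: SereginSverak2009, Thm. 1.1 (via `OneSymmetricSlice`)] -/
theorem discreteSymmetry_leaf (C K : ℝ) :
    ∃ α₀ > 0, ∃ R > 0,
      ∀ w : ℝ → EuclideanSpace ℝ (Fin 3) → EuclideanSpace ℝ (Fin 3), IsTypeIAncientMild C w →
      (∀ s : ℝ, s < 0 → ∫⁻ x, ‖fderiv ℝ (w s) x‖ₑ ^ 2 ≤ ENNReal.ofReal (K / Real.sqrt (-s))) →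
      (∃ t < 0, ∃ g : EuclideanSpace ℝ (Fin 3) ≃ₗᵢ[ℝ] EuclideanSpace ℝ (Fin 3), ∃ α : ℝ,
        0 < α ∧ α ≤ α₀ ∧ ∀ x ∈ ball (0 : EuclideanSpace ℝ (Fin 3)) (R * Real.sqrt (-t)),
          w t (g (rotZ α (g.symm x))) = g (rotZ α (g.symm (w t x)))) →
      ¬ (∀ r > 0, ∀ M : ℝ, ∃ t ∈ Set.Ioo (-(r ^ 2)) (0 : ℝ),
          ∃ x ∈ ball (0 : EuclideanSpace ℝ (Fin 3)) r, M < ‖w t x‖) := by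
  obtain ⟨α₀, hα₀, κ, hκ, R, hR, H⟩ := almostDiscreteSymmetry_leaf C K
  refine ⟨α₀, hα₀, R, hR, fun w hw hlaw ⟨t, ht, g, α, hα, hαle, hsym⟩ => ?_⟩
  refine H w hw hlaw ⟨t, ht, g, α, hα, hαle, fun x hx => ?_⟩
  rw [hsym x hx, sub_self, norm_zero, mul_zero]
  positivity

/-- **THE CRYSTALLOGRAPHIC RESTRICTION: every rotational symmetry of a finite-dissipation Type-I
singularity has finite order `≤ N(C,K)`.** For all `C, K` there are `N : ℕ`, `N ≥ 1`, and `R > 0` such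
that: if `w ∈ 𝒟_{C,K}` is SINGULAR (unbounded on every backward parabolic cylinder at the origin) and a
slice `t < 0` is symmetric on `B(0, R√(−t))` under the rotation `ρ_{g,α}` by the angle `α` about the
axis `g e₃`, then `k α ∈ 2πℤ` for some integer `1 ≤ k ≤ N` — i.e. `ρ_{g,α}^k = 1`.
[cite: SereginSverak2009, Thm. 1.1 (via `OneSymmetricSlice`)] -/
theorem symmetry_finiteOrder_of_singular (C K : ℝ) :
    ∃ N : ℕ, 0 < N ∧ ∃ R > 0,
      ∀ w : ℝ → EuclideanSpace ℝ (Fin 3) → EuclideanSpace ℝ (Fin 3), IsTypeIAncientMild C w →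
      (∀ s : ℝ, s < 0 → ∫⁻ x, ‖fderiv ℝ (w s) x‖ₑ ^ 2 ≤ ENNReal.ofReal (K / Real.sqrt (-s))) →
      (∀ r > 0, ∀ M : ℝ, ∃ t ∈ Set.Ioo (-(r ^ 2)) (0 : ℝ),
          ∃ x ∈ ball (0 : EuclideanSpace ℝ (Fin 3)) r, M < ‖w t x‖) →
      ∀ t < 0, ∀ g : EuclideanSpace ℝ (Fin 3) ≃ₗᵢ[ℝ] EuclideanSpace ℝ (Fin 3), ∀ α : ℝ,
        (∀ x ∈ ball (0 : EuclideanSpace ℝ (Fin 3)) (R * Real.sqrt (-t)),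
          w t (g (rotZ α (g.symm x))) = g (rotZ α (g.symm (w t x)))) →
        ∃ k : ℕ, 0 < k ∧ k ≤ N ∧ ∃ m : ℤ, (k : ℝ) * α = m * (2 * Real.pi) := by
  obtain ⟨α₀, hα₀, R, hR, H⟩ := discreteSymmetry_leaf C K
  set N : ℕ := ⌈2 * Real.pi / α₀⌉₊ + 1 with hN
  have hNpos : 0 < N := Nat.succ_pos _
  refine ⟨N, hNpos, R, hR, fun w hw hlaw hsing t ht g α hsym => ?_⟩
  have h2π : 0 < 2 * Real.pi := by positivity
  -- Dirichlet: `1 ≤ k ≤ N` with `|k (α/2π) − j| ≤ 1/(N+1)`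
  obtain ⟨j, k, hk0, hkN, hjk⟩ := Real.exists_int_int_abs_mul_sub_le (α / (2 * Real.pi)) hNpos
  set β : ℝ := (k : ℝ) * α - j * (2 * Real.pi) with hβ
  have hβsmall : |β| < α₀ := by
    have e : β = 2 * Real.pi * ((k : ℝ) * (α / (2 * Real.pi)) - j) := by
      have e' : 2 * Real.pi * ((k : ℝ) * (α / (2 * Real.pi))) = (k : ℝ) * α := by
        rw [← mul_assoc, mul_comm (2 * Real.pi) (k : ℝ), mul_assoc, mul_div_cancel₀ α h2π.ne']
      rw [hβ, mul_sub, e']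
      ring
    rw [e, abs_mul, abs_of_pos h2π]
    have hN1 : 2 * Real.pi / α₀ < (N : ℝ) + 1 := by
      have h1 : 2 * Real.pi / α₀ ≤ ⌈2 * Real.pi / α₀⌉₊ := Nat.le_ceil _
      have h2 : (N : ℝ) = ⌈2 * Real.pi / α₀⌉₊ + 1 := by rw [hN]; push_cast; ring
      linarith
    have hN1' : 1 / ((N : ℝ) + 1) < α₀ / (2 * Real.pi) := by
      rw [div_lt_div_iff₀ (by positivity) h2π]
      rw [div_lt_iff₀ hα₀] at hN1
      linarith
    calc 2 * Real.pi * |(k : ℝ) * (α / (2 * Real.pi)) - j| ≤ 2 * Real.pi * (1 / ((N : ℝ) + 1)) :=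
          mul_le_mul_of_nonneg_left hjk h2π.le
      _ < 2 * Real.pi * (α₀ / (2 * Real.pi)) := mul_lt_mul_of_pos_left hN1' h2π
      _ = α₀ := mul_div_cancel₀ α₀ h2π.ne'
  -- the natural number `k`
  obtain ⟨kn, hkn⟩ : ∃ kn : ℕ, (k : ℤ) = kn := ⟨k.toNat, (Int.toNat_of_nonneg hk0.le).symm⟩
  have hknR : (k : ℝ) = (kn : ℝ) := by exact_mod_cast hkn
  have hknpos : 0 < kn := by exact_mod_cast (hkn ▸ hk0)
  have hknN : kn ≤ N := by exact_mod_cast (hkn ▸ hkN)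
  -- the `k`-th iterate is a symmetry by the angle `β`
  have hsymk := iterate_symmetry g hsym kn
  have hsymβ : ∀ x ∈ ball (0 : EuclideanSpace ℝ (Fin 3)) (R * Real.sqrt (-t)),
      w t (g (rotZ β (g.symm x))) = g (rotZ β (g.symm (w t x))) := by
    intro x hx
    have e : ∀ z : EuclideanSpace ℝ (Fin 3), rotZ β z = rotZ ((kn : ℝ) * α) z := fun z => by
      rw [hβ, hknR, rotZ_sub_int_mul_two_pi]
    rw [e, e]
    exact hsymk x hx
  refine ⟨kn, hknpos, hknN, j, ?_⟩
  rw [← hknR]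
  -- trichotomy on `β`
  rcases lt_trichotomy β 0 with hneg | hzero | hpos
  · -- `-β ∈ (0, α₀)` is the angle of a symmetry: regular, contradiction
    exfalso
    have hβ' := symmetry_neg g hsymβ
    refine H w hw hlaw ⟨t, ht, g, -β, neg_pos.2 hneg, ?_, hβ'⟩ hsing
    have := neg_abs_le β
    rw [abs_of_neg hneg] at hβsmall
    linarith
  · rw [hβ] at hzero; linarith
  · exfalso
    refine H w hw hlaw ⟨t, ht, g, β, hpos, ?_, hsymβ⟩ hsing
    rw [abs_of_pos hpos] at hβsmall
    exact hβsmall.le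

/-- **No irrational-angle rotational symmetry.** For all `C, K` there is `R > 0` such that no slice of a
SINGULAR member of `𝒟_{C,K}` is symmetric on `B(0, R√(−t))` under a rotation about an axis through the
apex by an angle `α` with `α/(2π)` irrational. [cite: SereginSverak2009, Thm. 1.1 (via `OneSymmetricSlice`)] -/
theorem not_symmetric_of_irrational_of_singular (C K : ℝ) :
    ∃ R > 0,
      ∀ w : ℝ → EuclideanSpace ℝ (Fin 3) → EuclideanSpace ℝ (Fin 3), IsTypeIAncientMild C w →
      (∀ s : ℝ, s < 0 → ∫⁻ x, ‖fderiv ℝ (w s) x‖ₑ ^ 2 ≤ ENNReal.ofReal (K / Real.sqrt (-s))) →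
      (∀ r > 0, ∀ M : ℝ, ∃ t ∈ Set.Ioo (-(r ^ 2)) (0 : ℝ),
          ∃ x ∈ ball (0 : EuclideanSpace ℝ (Fin 3)) r, M < ‖w t x‖) →
      ∀ t < 0, ∀ g : EuclideanSpace ℝ (Fin 3) ≃ₗᵢ[ℝ] EuclideanSpace ℝ (Fin 3), ∀ α : ℝ,
        Irrational (α / (2 * Real.pi)) →
        ¬ (∀ x ∈ ball (0 : EuclideanSpace ℝ (Fin 3)) (R * Real.sqrt (-t)),
          w t (g (rotZ α (g.symm x))) = g (rotZ α (g.symm (w t x)))) := by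
  obtain ⟨N, hN, R, hR, H⟩ := symmetry_finiteOrder_of_singular C K
  refine ⟨R, hR, fun w hw hlaw hsing t ht g α hirr hsym => ?_⟩
  obtain ⟨k, hk, -, m, hkm⟩ := H w hw hlaw hsing t ht g α hsym
  have h2π : (2 * Real.pi) ≠ 0 := by positivity
  have hk0 : (k : ℝ) ≠ 0 := by exact_mod_cast hk.ne'
  have e : α / (2 * Real.pi) = (m : ℝ) / (k : ℝ) := by
    rw [div_eq_div_iff h2π hk0]
    linarith
  exact (irrational_iff_ne_rational _).1 hirr m k (by exact_mod_cast hk.ne') e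

/-- **PORTRAIT CLAUSE (skeleton form): singular members have no small-angle rotational symmetry.** For
all `C, K` there are `α₀, R > 0` such that every SINGULAR member of `𝒟_{C,K}`, at EVERY instant `t < 0`,
for every axis through the apex and every angle `0 < α ≤ α₀`, has a point of the similarity ball
`B(0, R√(−t))` where the rotational symmetry `ρ_{g,α}` fails. [cite: SereginSverak2009, Thm. 1.1 (via `OneSymmetricSlice`)] -/
theorem smallRotation_defect_of_singular (C K : ℝ) :
    ∃ α₀ > 0, ∃ R > 0,
      ∀ w : ℝ → EuclideanSpace ℝ (Fin 3) → EuclideanSpace ℝ (Fin 3), IsTypeIAncientMild C w →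
      (∀ s : ℝ, s < 0 → ∫⁻ x, ‖fderiv ℝ (w s) x‖ₑ ^ 2 ≤ ENNReal.ofReal (K / Real.sqrt (-s))) →
      (∀ r > 0, ∀ M : ℝ, ∃ t ∈ Set.Ioo (-(r ^ 2)) (0 : ℝ),
          ∃ x ∈ ball (0 : EuclideanSpace ℝ (Fin 3)) r, M < ‖w t x‖) →
      ∀ t < 0, ∀ g : EuclideanSpace ℝ (Fin 3) ≃ₗᵢ[ℝ] EuclideanSpace ℝ (Fin 3), ∀ α : ℝ, 0 < α → α ≤ α₀ →
        ∃ x ∈ ball (0 : EuclideanSpace ℝ (Fin 3)) (R * Real.sqrt (-t)),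
          w t (g (rotZ α (g.symm x))) ≠ g (rotZ α (g.symm (w t x))) := by
  obtain ⟨α₀, hα₀, R, hR, H⟩ := discreteSymmetry_leaf C K
  refine ⟨α₀, hα₀, R, hR, fun w hw hlaw hsing t ht g α hα hαle => ?_⟩
  by_contra hcon
  push Not at hcon
  exact H w hw hlaw ⟨t, ht, g, α, hα, hαle, hcon⟩ hsing


/-! ### The full point group: every `O(3)`-symmetry has finite order `≤ 2N(C,K)` -/

/-- Powers of a conjugated rotation in the group `ℝ³ ≃ₗᵢ ℝ³`: `(P⁻¹ R_θ P)^k = P⁻¹ R_{kθ} P`,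
pointwise. -/
theorem conj_pow_apply (P : EuclideanSpace ℝ (Fin 3) ≃ₗᵢ[ℝ] EuclideanSpace ℝ (Fin 3)) (θ : ℝ) :
    ∀ (k : ℕ) (x : EuclideanSpace ℝ (Fin 3)),
      (((P.symm.trans (rotZLIE θ)).trans P) ^ k) x = P (rotZ ((k : ℝ) * θ) (P.symm x)) := by
  intro k
  induction k with
  | zero =>
    intro x
    simp [rotZ_zero]
  | succ k ih =>
    intro x
    rw [pow_succ, LinearIsometryEquiv.coe_mul, Function.comp_apply]
    simp only [LinearIsometryEquiv.trans_apply, rotZLIE_apply]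
    rw [ih, LinearIsometryEquiv.symm_apply_apply, ← rotZ_add]
    congr 2
    push_cast
    ring

/-- **THE FULL POINT GROUP IS A TORSION GROUP OF BOUNDED EXPONENT.** For all `C, K` there are
`N : ℕ`, `N ≥ 1`, and `R > 0` such that every linear isometry `S` of `ℝ³` — proper OR improper
(reflections, rotoreflections, the inversion) — under which a slice `t < 0` of a SINGULAR member of
`𝒟_{C,K}` is symmetric on the similarity ball `B(0, R√(−t))` (`w(t, Sx) = S w(t, x)`) satisfies
`S^k = 1` for some `1 ≤ k ≤ N` (Euler: `S ∘ S` is a proper rotation, conjugate to some `R_θ` —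
`TwistNormalForm.exists_trans_self_eq_conj_rotZLIE`; the slice is `S∘S`-symmetric on the ball; the
crystallographic restriction bounds the order of `θ`). [cite: SereginSverak2009, Thm. 1.1 (via `OneSymmetricSlice`)] -/
theorem isometrySymmetry_finiteOrder_of_singular (C K : ℝ) :
    ∃ N : ℕ, 0 < N ∧ ∃ R > 0,
      ∀ w : ℝ → EuclideanSpace ℝ (Fin 3) → EuclideanSpace ℝ (Fin 3), IsTypeIAncientMild C w →
      (∀ s : ℝ, s < 0 → ∫⁻ x, ‖fderiv ℝ (w s) x‖ₑ ^ 2 ≤ ENNReal.ofReal (K / Real.sqrt (-s))) →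
      (∀ r > 0, ∀ M : ℝ, ∃ t ∈ Set.Ioo (-(r ^ 2)) (0 : ℝ),
          ∃ x ∈ ball (0 : EuclideanSpace ℝ (Fin 3)) r, M < ‖w t x‖) →
      ∀ t < 0, ∀ S : EuclideanSpace ℝ (Fin 3) ≃ₗᵢ[ℝ] EuclideanSpace ℝ (Fin 3),
        (∀ x ∈ ball (0 : EuclideanSpace ℝ (Fin 3)) (R * Real.sqrt (-t)), w t (S x) = S (w t x)) →
        ∃ k : ℕ, 0 < k ∧ k ≤ N ∧ S ^ k = 1 := by
  obtain ⟨N, hN, R, hR, H⟩ := symmetry_finiteOrder_of_singular C K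
  refine ⟨2 * N, by omega, R, hR, fun w hw hlaw hsing t ht S hsym => ?_⟩
  -- Euler: `S ∘ S = P R_θ P⁻¹`
  obtain ⟨P, θ, hSS⟩ := TwistNormalForm.exists_trans_self_eq_conj_rotZLIE S
  have hSSx : ∀ x : EuclideanSpace ℝ (Fin 3), S (S x) = P (rotZ θ (P.symm x)) := fun x => by
    have := congrArg (fun e : EuclideanSpace ℝ (Fin 3) ≃ₗᵢ[ℝ] EuclideanSpace ℝ (Fin 3) => e x) hSS
    simpa [LinearIsometryEquiv.trans_apply] using this
  -- the slice is `S∘S`-symmetric on the ball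
  have hsym2 : ∀ x ∈ ball (0 : EuclideanSpace ℝ (Fin 3)) (R * Real.sqrt (-t)),
      w t (P (rotZ θ (P.symm x))) = P (rotZ θ (P.symm (w t x))) := by
    intro x hx
    have hSx : S x ∈ ball (0 : EuclideanSpace ℝ (Fin 3)) (R * Real.sqrt (-t)) := by
      rw [mem_ball_zero_iff] at hx ⊢
      rwa [LinearIsometryEquiv.norm_map]
    rw [← hSSx, ← hSSx, hsym (S x) hSx, hsym x hx]
  obtain ⟨k, hk, hkN, m, hkm⟩ := H w hw hlaw hsing t ht P θ hsym2
  refine ⟨2 * k, by omega, by omega, ?_⟩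
  -- `S^(2k) = (S∘S)^k = P R_{kθ} P⁻¹ = P R_{2πm} P⁻¹ = 1`
  have hS2 : S ^ 2 = (P.symm.trans (rotZLIE θ)).trans P := by
    rw [pow_two, LinearIsometryEquiv.mul_def, hSS]
  rw [pow_mul, hS2]
  apply LinearIsometryEquiv.ext
  intro x
  rw [conj_pow_apply, hkm, LinearIsometryEquiv.coe_one, id]
  have : rotZ ((m : ℝ) * (2 * Real.pi)) (P.symm x) = P.symm x := by
    have h := PointGroup.rotZ_sub_int_mul_two_pi ((m : ℝ) * (2 * Real.pi)) m (P.symm x)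
    rw [sub_self, rotZ_zero] at h
    exact h.symm
  rw [this, LinearIsometryEquiv.apply_symm_apply]

end Summit.NavierStokesRegularity.NavierStokesRegularity.Theorems.FiniteDissipationLiouville.PointGroup
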